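import Summits.ValiantsHypothesis.ValiantsHypothesis.Theorems.BarrierLeverChowThinRowsTwinPeelForms
import Summits.ValiantsHypothesis.ValiantsHypothesis.Theorems.BarrierLeverPartitionMinorsChowSwap

/-!
# Route BarrierLever — item `ChowHitsThinRowPartitionMinors` (stmt-ValiantsHypothesis-20195):
# the FIRST-ORDER-ROWS slice on every TWIN-PEELABLE column family, every height

Helper file (`--supports stmt-ValiantsHypothesis-20195`; cell valiant-natproofs, rung V4, 𝒟-side of
door (c); prover seat valiant-natproofs-prover gen 11).  Closes NO item; imports parts I/II
(`…ChowThinRowsTwinPeelSpan`, `…ChowThinRowsTwinPeelForms`) and seat val-np-p4's `x ↔ y` swap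
`…PartitionMinorsChowSwap` (no route file).

Conventions of items 19717 / 20172 / 20195: `x_a = X (castAdd h a)`, `y_c = X (natAdd h c)` in
`MvPolynomial (Fin (h+h)) ℂ`; the partition-matrix entry of `f` at `(u, w)` is `coeff (E u w) f`,
`E u w = Σ_{a ∈ u} single (castAdd h a) 1 + Σ_{c ∈ w} single (natAdd h c) 1`.

**`chowHits_firstOrderRows_of_spanPos` (assembly).**  A family `𝒦` of at most `h + h` subsets with
SPAN(𝒦, 𝒲) and POS(𝒦, 𝒲) (part I) hits every layout with injective rows of size `≤ 1` and injective
columns from `𝒲`: the witness is the product of the indicator forms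
`1 + Σ_a κ_a(V) x_a + Σ_{c ∈ V} y_c`, `V ∈ 𝒦`, padded with ones, where the `x`-coefficients are SOLVED
(SPAN + prover g10's derivative formula `coeff_single_prod`) so that the singleton row `{a_i}` is the
indicator of its own column; the `∅`-row is the full product (nonzero on every column by POS) and the
minor is the identity with one row replaced.  This is prover g10's sub-cube assembly with the square
basis replaced by a spanning family.

**MAIN THEOREM `chowHits_firstOrderRows_of_twinPeeling`.**  For every height `h`, every column family
`𝒲` and every TWIN-PEELING of it — coordinates `cs 0, …, cs (p-1)` (pairwise distinct) such that at
each stage `t`, after deleting `S_t = {cs s : s < t}` from every column, the coordinate `cs t` has AT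
MOST ONE TWIN PAIR `{W', W' ∪ {cs t}}` among the peeled columns (every such `W'` equals the given
`w0 t`) — with budget `|𝒟| + p ≤ h + h`, `𝒟` the down-closure of the terminal family `{W \ S_p}`:
every partition minor with injective rows `u i` of size `≤ 1` and injective columns `w j ∈ 𝒲` (any
`r`) is nonzero at ONE explicit product of `h + h` affine forms (item 20195's conclusion verbatim on
that slice).  Special cases: `p = 0` = prover g10's `chowHits_firstOrderRows_smallShadow` (hence the
sub-cube / down-closed classes); affinely independent columns (val-np-p7's
`chow_hit_thin1_of_affineIndependent`) have every coordinate in at most one twin pair; NEW are all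
affinely dependent families that peel to a small shadow, e.g. `K₄ - e` as 2-sets `{01,02,03,12,13}`,
the resistant archetype `{a},{b},{ac},{bc},{abc}` of val-np-p2's certificate census, cones
`{∅} ∪ {W ∪ {c} : W ∈ 2^T}`.  Corollaries: `chowHits_firstOrderRows_of_oneTwinPeel` (`p = 1` spelled
out) and the `x ↔ y` mirror `chowHits_twinPeelingRows_firstOrderColumns`.

REACH (seat folder lab/peel*.py, exact): at `n = 4` column coordinates and minimal height, twin
peeling certifies 36 816 / 38 260 column families (`2 ≤ r ≤ 8`, all coordinates used) against
16 122 for small-shadow ∪ affinely-independent and 24 098 with zero-twin peeling added; the residual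
87 `S₄`-classes form the 2-thick core (every coordinate in ≥ 2 twin pairs).

WHAT THIS IS NOT: the first-order-rows slice of item 20195 is NOT proved for all column families (the
2-thick core is open in the kernel; val-np-p7's UDC theorems cover part of it on paper); nothing on
rows of size 2 (val-np-p8's pair layer), on items 20172 / 19717, on crux stmt-ValiantsHypothesis-14610,
or on `VP` versus `VNP`.

References: [ForbesShpilkaVolk2018] §8 (partition-matrix / read-once distinguishers); Nisan 1991
(partition matrices); planner valiant-natproofs-p1 g14, MEMO-thinrows-proofplan.md §9 (twin
collisions, the 2-thick gap); prover g10 `…ChowThinRowsSubcube`; val-np-p7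
`…ChowThinSeparatingReduction`.
-/

set_option linter.dupNamespace false

namespace Summit.ValiantsHypothesis.ValiantsHypothesis.Theorems.BarrierLever.ChowTwinPeel

open Finset MvPolynomial
open Summit.ValiantsHypothesis.ValiantsHypothesis.Theorems.BarrierLever.ChowFactor
  (totalDegree_affine_le)
open Summit.ValiantsHypothesis.ValiantsHypothesis.Theorems.BarrierLever.ChowSubcube
  (coeff_single_prod coeff_empty_prod_eq exists_forms_of_card_le det_one_updateRow)

variable {h : ℕ}

/-- **Matrix assembly: SPAN + POS ⇒ the first-order-rows slice.**  If a family `𝒦` of at most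
`h + h` subsets has SPAN(𝒦, 𝒲) and POS(𝒦, 𝒲), then every layout with injective rows of size `≤ 1` and
injective columns from `𝒲` is hit by a product of `h + h` affine forms (item 20195's matrix verbatim):
the indicator forms `1 + Σ_a κ_a(V) x_a + Σ_{c ∈ V} y_c`, `V ∈ 𝒦`, padded with ones, where the
`x`-coefficients `κ` are SOLVED (by SPAN and the derivative formula `coeff_single_prod`) so that the
singleton row `{a_i}` is the indicator of its own column `w i`; the `∅`-row is the full product, nonzero
on every column by POS, and the minor is the identity with one row replaced (`det_one_updateRow`).
This is prover g10's sub-cube assembly with the square basis replaced by a spanning family. -/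
theorem chowHits_firstOrderRows_of_spanPos (𝒦 𝒲 : Finset (Finset (Fin h))) (hcard : 𝒦.card ≤ h + h)
    (hpos : ∀ W ∈ 𝒲, coeff (∑ a ∈ (∅ : Finset (Fin h)), Finsupp.single (Fin.castAdd h a) 1 +
        ∑ c' ∈ W, Finsupp.single (Fin.natAdd h c') 1)
      (∏ V ∈ 𝒦, (C 1 + ∑ a, C ((fun (_ : Fin h) (_ : Finset (Fin h)) =>
        (0 : ℂ)) a V) * X (Fin.castAdd h a) + ∑ c', C (if c' ∈ V then (1 : ℂ) else 0) *
        X (Fin.natAdd h c') : MvPolynomial (Fin (h + h)) ℂ)) ≠ 0)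
    (hspan : ∀ g : Finset (Fin h) → ℂ, ∃ cV : Finset (Fin h) → ℂ, ∀ W ∈ 𝒲,
      ∑ V ∈ 𝒦, cV V * coeff (∑ a ∈ (∅ : Finset (Fin h)), Finsupp.single (Fin.castAdd h a) 1 +
          ∑ c' ∈ W, Finsupp.single (Fin.natAdd h c') 1)
        (∏ V' ∈ 𝒦.erase V, (C 1 + ∑ a, C ((fun (_ : Fin h) (_ : Finset (Fin h)) =>
          (0 : ℂ)) a V') * X (Fin.castAdd h a) + ∑ c', C (if c' ∈ V' then (1 : ℂ) else 0) *
          X (Fin.natAdd h c') : MvPolynomial (Fin (h + h)) ℂ)) = g W)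
    (r : ℕ) (u w : Fin r → Finset (Fin h))
    (hu : Function.Injective u) (hw : Function.Injective w)
    (hu1 : ∀ i, (u i).card ≤ 1) (hw𝒲 : ∀ j, w j ∈ 𝒲) :
    ∃ ℓ : Fin (h + h) → MvPolynomial (Fin (h + h)) ℂ, (∀ k, (ℓ k).totalDegree ≤ 1) ∧
      (Matrix.of fun i j : Fin r => MvPolynomial.coeff
        (∑ a ∈ u i, Finsupp.single (Fin.castAdd h a) 1 +
          ∑ c ∈ w j, Finsupp.single (Fin.natAdd h c) 1) (∏ k, ℓ k)).det ≠ 0 := by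
  classical
  -- Step 1: the `x`-coefficients: row `{a}` (if `u i = {a}`) is sent to the indicator of column `w i`
  choose cvec hcvec using fun i : Fin r => hspan (fun W => if W = w i then (1 : ℂ) else 0)
  obtain ⟨κ, hκ⟩ : ∃ κ : Fin h → Finset (Fin h) → ℂ, ∀ i a, u i = {a} → ∀ V, κ a V = cvec i V := by
    refine ⟨fun a V => if hx : ∃ i, u i = {a} then cvec (Classical.choose hx) V else 0, ?_⟩
    intro i a hia V
    have hx : ∃ i, u i = {a} := ⟨i, hia⟩
    have hi : Classical.choose hx = i := hu ((Classical.choose_spec hx).trans hia.symm)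
    simp only [dif_pos hx, hi]
  -- Step 2: the forms and their embedding into `Fin (h + h)`
  obtain ⟨ℓ, hℓdeg, hℓprod⟩ := exists_forms_of_card_le 𝒦 hcard
    (fun V => C 1 + ∑ a, C (κ a V) * X (Fin.castAdd h a) +
      ∑ c, C (if c ∈ V then (1 : ℂ) else 0) * X (Fin.natAdd h c))
    (fun V _ => by
      have e : (C 1 + ∑ a, C (κ a V) * X (Fin.castAdd h a) +
          ∑ c, C (if c ∈ V then (1 : ℂ) else 0) * X (Fin.natAdd h c) : MvPolynomial (Fin (h + h)) ℂ) =
          C 1 + ∑ v : Fin (h + h), C (Fin.append (fun a => κ a V)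
            (fun c => if c ∈ V then (1 : ℂ) else 0) v) * X v := by
        rw [Fin.sum_univ_add]
        simp only [Fin.append_left, Fin.append_right, add_assoc]
      rw [e]
      exact totalDegree_affine_le _ _)
  refine ⟨ℓ, hℓdeg, ?_⟩
  rw [hℓprod]
  -- Step 3: the entries of the partition minor
  set bW : Finset (Fin h) → ℂ := fun W' =>
    coeff (∑ a ∈ (∅ : Finset (Fin h)), Finsupp.single (Fin.castAdd h a) 1 +
        ∑ c ∈ W', Finsupp.single (Fin.natAdd h c) 1)
      (∏ V ∈ 𝒦, (C 1 + ∑ a, C (κ a V) * X (Fin.castAdd h a) +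
        ∑ c, C (if c ∈ V then (1 : ℂ) else 0) * X (Fin.natAdd h c))) with hbW
  have hentry_single : ∀ i j a, u i = {a} →
      coeff (∑ a' ∈ u i, Finsupp.single (Fin.castAdd h a') 1 +
          ∑ c ∈ w j, Finsupp.single (Fin.natAdd h c) 1)
        (∏ V ∈ 𝒦, (C 1 + ∑ a, C (κ a V) * X (Fin.castAdd h a) +
          ∑ c, C (if c ∈ V then (1 : ℂ) else 0) * X (Fin.natAdd h c))) =
        if i = j then 1 else 0 := by
    intro i j a hia
    rw [hia, coeff_single_prod]
    have hsum : ∑ V ∈ 𝒦, κ a V *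
        coeff (∑ a' ∈ (∅ : Finset (Fin h)), Finsupp.single (Fin.castAdd h a') 1 +
            ∑ c ∈ w j, Finsupp.single (Fin.natAdd h c) 1)
          (∏ V' ∈ 𝒦.erase V, (C 1 + ∑ a, C (κ a V') * X (Fin.castAdd h a) +
            ∑ c, C (if c ∈ V' then (1 : ℂ) else 0) * X (Fin.natAdd h c))) =
        ∑ V ∈ 𝒦, cvec i V *
          coeff (∑ a' ∈ (∅ : Finset (Fin h)), Finsupp.single (Fin.castAdd h a') 1 +
              ∑ c ∈ w j, Finsupp.single (Fin.natAdd h c) 1)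
            (∏ V' ∈ 𝒦.erase V, (C 1 + ∑ a, C ((fun (_ : Fin h) (_ : Finset (Fin h)) => (0 : ℂ)) a V') *
              X (Fin.castAdd h a) + ∑ c, C (if c ∈ V' then (1 : ℂ) else 0) * X (Fin.natAdd h c))) := by
      refine Finset.sum_congr rfl fun V _ => ?_
      rw [hκ i a hia V, coeff_empty_prod_eq κ (fun _ _ => (0 : ℂ)) (𝒦.erase V) (w j)]
    rw [hsum, hcvec i (w j) (hw𝒲 j)]
    by_cases hij : i = j
    · subst hij; simp
    · rw [if_neg (fun e' => hij (hw e'.symm)), if_neg hij]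
  -- Step 4: the determinant
  by_cases h0 : ∃ i₀, u i₀ = ∅
  · obtain ⟨i₀, hi₀⟩ := h0
    have hdet : (Matrix.of fun i j : Fin r => MvPolynomial.coeff
        (∑ a ∈ u i, Finsupp.single (Fin.castAdd h a) 1 +
          ∑ c ∈ w j, Finsupp.single (Fin.natAdd h c) 1)
        (∏ V ∈ 𝒦, (C 1 + ∑ a, C (κ a V) * X (Fin.castAdd h a) +
          ∑ c, C (if c ∈ V then (1 : ℂ) else 0) * X (Fin.natAdd h c)))).det = bW (w i₀) := by
      refine det_one_updateRow _ i₀ (fun j => bW (w j)) fun i j => ?_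
      rw [Matrix.of_apply]
      by_cases hi : i = i₀
      · subst hi
        rw [if_pos rfl, hi₀]
      · rw [if_neg hi]
        have hne : u i ≠ ∅ := fun e => hi (hu (e.trans hi₀.symm))
        have hcard1 : (u i).card = 1 := by
          have := hu1 i
          have hpos' := Finset.card_pos.mpr (Finset.nonempty_iff_ne_empty.mpr hne)
          omega
        obtain ⟨a, ha⟩ := Finset.card_eq_one.mp hcard1
        exact hentry_single i j a ha
    rw [hdet, hbW]
    dsimp only
    rw [coeff_empty_prod_eq κ (fun _ _ => (0 : ℂ)) 𝒦 (w i₀)]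
    exact hpos (w i₀) (hw𝒲 i₀)
  · have hdet : (Matrix.of fun i j : Fin r => MvPolynomial.coeff
        (∑ a ∈ u i, Finsupp.single (Fin.castAdd h a) 1 +
          ∑ c ∈ w j, Finsupp.single (Fin.natAdd h c) 1)
        (∏ V ∈ 𝒦, (C 1 + ∑ a, C (κ a V) * X (Fin.castAdd h a) +
          ∑ c, C (if c ∈ V then (1 : ℂ) else 0) * X (Fin.natAdd h c)))) = 1 := by
      ext i j
      rw [Matrix.of_apply, Matrix.one_apply]
      have hne : u i ≠ ∅ := fun e => h0 ⟨i, e⟩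
      have hcard1 : (u i).card = 1 := by
        have := hu1 i
        have hpos' := Finset.card_pos.mpr (Finset.nonempty_iff_ne_empty.mpr hne)
        omega
      obtain ⟨a, ha⟩ := Finset.card_eq_one.mp hcard1
      exact hentry_single i j a ha
    rw [hdet, Matrix.det_one]
    exact one_ne_zero

/-- **MAIN THEOREM — thin-row CPM on first-order rows × any TWIN-PEELABLE column family, every
height** (item `ChowHitsThinRowPartitionMinors`, stmt-ValiantsHypothesis-20195, restricted to rows of
size `≤ 1`).  Data: a column family `𝒲` (containing all the columns `w j`), coordinates
`cs 0, …, cs (p-1)` (pairwise distinct) and twin bases `w0 t`.  Hypotheses: at each stage `t` (with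
`S_t = {cs s : s < t}` peeled), AT MOST ONE TWIN PAIR along `cs t` — every `W ∈ 𝒲` with `cs t ∉ W`
whose peeled set `W \ S_t` has `(W \ S_t) ∪ {cs t}` among the peeled columns equals `w0 t` after
peeling; and the budget `|𝒟| + p ≤ h + h`, `𝒟` the down-closure of the terminal family `{W \ S_p}`.
Then ONE explicit product of `h + h` affine forms — `(1 + y_{cs t} + x-part)` for `t < p`, the indicator
forms of `𝒟` with `x`-parts, and ones — makes every partition minor with injective rows of size `≤ 1`
and injective columns in `𝒲` nonsingular.  `p = 0` is prover g10's `chowHits_firstOrderRows_smallShadow`;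
affinely independent columns (val-np-p7) have every coordinate in at most one twin pair. -/
theorem chowHits_firstOrderRows_of_twinPeeling (h p : ℕ) (𝒲 : Finset (Finset (Fin h)))
    (cs : ℕ → Fin h) (w0 : ℕ → Finset (Fin h))
    (hinj : ∀ s, s < p → ∀ t, t < p → cs s = cs t → s = t)
    (htwin : ∀ t, t < p → ∀ W ∈ 𝒲, cs t ∉ W →
      insert (cs t) (W \ (Finset.range t).image cs) ∈
        𝒲.image (fun W' => W' \ (Finset.range t).image cs) →
      W \ (Finset.range t).image cs = w0 t)
    (hbudget : ((𝒲.image (fun W => W \ (Finset.range p).image cs)).biUnion Finset.powerset).card + p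
      ≤ h + h)
    (r : ℕ) (u w : Fin r → Finset (Fin h))
    (hu : Function.Injective u) (hw : Function.Injective w)
    (hu1 : ∀ i, (u i).card ≤ 1) (hw𝒲 : ∀ j, w j ∈ 𝒲) :
    ∃ ℓ : Fin (h + h) → MvPolynomial (Fin (h + h)) ℂ, (∀ k, (ℓ k).totalDegree ≤ 1) ∧
      (Matrix.of fun i j : Fin r => MvPolynomial.coeff
        (∑ a ∈ u i, Finsupp.single (Fin.castAdd h a) 1 +
          ∑ c ∈ w j, Finsupp.single (Fin.natAdd h c) 1) (∏ k, ℓ k)).det ≠ 0 := by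
  obtain ⟨𝒦, hcard, _, hpos, hspan⟩ := exists_forms_of_twinPeeling p 𝒲 cs w0 hinj htwin
  exact chowHits_firstOrderRows_of_spanPos 𝒦 𝒲 (hcard.trans hbudget) hpos hspan r u w hu hw hu1 hw𝒲

/-- **One twin-peel** (the simplest new case, `p = 1`): a coordinate `c` with AT MOST ONE TWIN PAIR
`{w₀, w₀ ∪ {c}}` among the columns, such that the `c`-peeled columns `{w j \ {c}}` have a down-closure
of at most `h + h - 1` sets.  Then the first-order-rows slice holds for these columns. -/
theorem chowHits_firstOrderRows_of_oneTwinPeel (h : ℕ) (c : Fin h) (w₀ : Finset (Fin h))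
    (r : ℕ) (u w : Fin r → Finset (Fin h))
    (hu : Function.Injective u) (hw : Function.Injective w) (hu1 : ∀ i, (u i).card ≤ 1)
    (htwin : ∀ j j', c ∉ w j → w j' = insert c (w j) → w j = w₀)
    (hbudget : (((Finset.univ : Finset (Fin r)).image (fun j => (w j).erase c)).biUnion
      Finset.powerset).card + 1 ≤ h + h) :
    ∃ ℓ : Fin (h + h) → MvPolynomial (Fin (h + h)) ℂ, (∀ k, (ℓ k).totalDegree ≤ 1) ∧
      (Matrix.of fun i j : Fin r => MvPolynomial.coeff
        (∑ a ∈ u i, Finsupp.single (Fin.castAdd h a) 1 +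
          ∑ c ∈ w j, Finsupp.single (Fin.natAdd h c) 1) (∏ k, ℓ k)).det ≠ 0 := by
  classical
  refine chowHits_firstOrderRows_of_twinPeeling h 1 ((Finset.univ : Finset (Fin r)).image w)
    (fun _ => c) (fun _ => w₀) (fun s hs t ht _ => by omega) ?_ ?_ r u w hu hw hu1
    (fun j => Finset.mem_image_of_mem w (Finset.mem_univ j))
  · intro t ht W hW hcW hins
    have ht0 : t = 0 := by omega
    subst ht0
    have h0 : (Finset.range 0).image (fun _ : ℕ => c) = (∅ : Finset (Fin h)) := by simp
    simp only [h0, Finset.sdiff_empty, Finset.image_id'] at hins ⊢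
    rw [Finset.mem_image] at hW hins
    obtain ⟨j, _, rfl⟩ := hW
    obtain ⟨j', _, hj'⟩ := hins
    exact htwin j j' hcW hj'
  · have h1 : (Finset.range 1).image (fun _ : ℕ => c) = ({c} : Finset (Fin h)) := by simp
    rw [h1, Finset.image_image]
    have e : (fun W : Finset (Fin h) => W \ ({c} : Finset (Fin h))) ∘ w = fun j => (w j).erase c := by
      funext j
      simp [Finset.sdiff_singleton_eq_erase]
    rw [e]
    exact hbudget

/-- **Twin-peelable rows × first-order columns, every height**: the `x ↔ y` mirror of
`chowHits_firstOrderRows_of_twinPeeling` (seat val-np-p4's `chow_hit_swap`). -/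
theorem chowHits_twinPeelingRows_firstOrderColumns (h p : ℕ) (𝒰 : Finset (Finset (Fin h)))
    (cs : ℕ → Fin h) (u0 : ℕ → Finset (Fin h))
    (hinj : ∀ s, s < p → ∀ t, t < p → cs s = cs t → s = t)
    (htwin : ∀ t, t < p → ∀ U ∈ 𝒰, cs t ∉ U →
      insert (cs t) (U \ (Finset.range t).image cs) ∈
        𝒰.image (fun U' => U' \ (Finset.range t).image cs) →
      U \ (Finset.range t).image cs = u0 t)
    (hbudget : ((𝒰.image (fun U => U \ (Finset.range p).image cs)).biUnion Finset.powerset).card + p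
      ≤ h + h)
    (r : ℕ) (u w : Fin r → Finset (Fin h))
    (hu : Function.Injective u) (hw : Function.Injective w)
    (hu𝒰 : ∀ i, u i ∈ 𝒰) (hw1 : ∀ j, (w j).card ≤ 1) :
    ∃ ℓ : Fin (h + h) → MvPolynomial (Fin (h + h)) ℂ, (∀ k, (ℓ k).totalDegree ≤ 1) ∧
      (Matrix.of fun i j : Fin r => MvPolynomial.coeff
        (∑ a ∈ u i, Finsupp.single (Fin.castAdd h a) 1 +
          ∑ c ∈ w j, Finsupp.single (Fin.natAdd h c) 1) (∏ k, ℓ k)).det ≠ 0 :=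
  ChowFactor.chow_hit_swap u w
    (chowHits_firstOrderRows_of_twinPeeling h p 𝒰 cs u0 hinj htwin hbudget r w u hw hu hw1 hu𝒰)

end Summit.ValiantsHypothesis.ValiantsHypothesis.Theorems.BarrierLever.ChowTwinPeel
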